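import Summits.HodgeConjecture.HodgeConjecture.Theorems.R90S9PureTensorTwistTransport     -- ★ p865038 (this seat), ORGAN PART 1: `twistAt`, `transportAlong`, `eval_twistAt_eq_of_eval_eq`, `mulConv_map_comp_symm`
import Summits.HodgeConjecture.HodgeConjecture.Theorems.R90S9TransferPairExistsOfKitLaws    -- ★ p862997 (p02): `smooth_tensOfPair_of_kitLaw`; cone ★ `Smooth_cm` `Transfer_cm` (p862941), `tensOfPair` `tensOfPair_eq_tens₀` `isKcBiInv_tensOfPair` (p862596∕p862626)
import Summits.HodgeConjecture.HodgeConjecture.Theorems.R90S9InnerFormSec146Levels          -- ★ p862556: `Level`, `HeckeOff`, `twistTest`, `IsLevelTest`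
import HarnessLib

/-!
# (tw-close) ORGAN PART 2 — the CLOSED twist `transportTwist` on `C_c(U(H′)(𝔸))` and FILE B's `hTw` from the transfer pin

Support file for `stmt-HodgeConjecture-24833` (h413, [Rogawski1990] Thm. 14.6.1 for HC_CM), route `route-HodgeConjecture-HCCMUnconditional`, section S9
(dealer R90-IF-plan (g2), deal 03:04:30Z «(tw-close) ORGAN», PART 2; seat R90-IF-p04 (g3)).  Over ★ p865038 (PART 1: `twistAt`, `transportAlong`, the
well-definedness heart `eval_twistAt_eq_of_eval_eq`, the convolution transport `mulConv_map_comp_symm`).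

FILE B ED. 4 (HOME cand v0.1 9c821f62) carries the quasi-split-side Hecke twist as ∃-DATA `tw : ∀ l, HeckeOff L H l → TestG L → TestG L` with the producer
group `hTw` (:1394).  Here `tw` is CLOSED and `hTw` is PROVED, generically in the kit's predicates, modulo exactly two pins B already holds: pin (iv) «a test
pure tensor is `Smooth`» (`hsm`) and the DEFINITIONAL transfer pin `PinTransferIff` (`hTiff`, B: `IsPinned.transfer_iff_local hpin`; the archimedean inner
transfer enters as an opaque `ArchRel`).
* §6 **SMOOTHNESS OF THE TWIST WITHOUT MEASURE HYPOTHESES**: `f ⋆ k` is locally constant as soon as `k` is right-invariant under a neighbourhood of `1`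
  (`isLocallyConstant_mulConv_of_forall_mul_right_eq` — termwise, no invariance of the measure), so `twistAt T 𝒯 k μ` is a TEST tensor for right-smooth compactly
  supported kernels and ANY local measures (`twistAt_isTest_of_forall_mul_right_eq`); right-smoothness transports along `ψ_v` (`…_comp_symm`) — the form needed
  on `U(H′)`, where `h_v ∘ ψ_v⁻¹` is only `ψ_v(K_v)`-invariant.
* §7 `twistAt_loc_eq_comp_symm`: twists of LOCALLY MATCHING tensors by `k` resp. `k ∘ ψ⁻¹` w.r.t. `μ` resp. `ψ_* μ` match locally (★ §5).
* §8 **`transportTwist ψ μ 𝒯 k hk f`** (honest `def`): for smooth `f` (`⇑f = T′.eval`, `T′` test) the `C_c`-packaging (★ `PureTensor.toCc`) of the twist of a CHOSEN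
  such `T′` by the transported kernels, else `0`; `coe_transportTwist`: its underlying function is `(twistAt T′ 𝒯 (k ∘ ψ⁻¹) (ψ_* μ)).eval` for EVERY test
  presentation `T′` (★ §4 heart) — what the eigen-law organ (p06 (P6-b)) reads `tw l h f` through; **`transfer_twistAt_transportTwist`**: for any
  `Transfer` pinned to local matching along `ψ`, `Transfer f′ f` ⇒ `Transfer g′ (transportTwist … f)` for every `g′` twisting a factorisation of `f′`.
* §9 (`N = 3`, the record's pairs) `testPred_twistTest`: `𝓕₀` is closed under `twistTest` for ANY local measures; **`coe_tensOfPair_twistTest`**: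
  `⇑(tensOfPair (twistTest l h p)) = (twistAt T₀ h.T h.loc μ).eval` for ANY unramified factorisation `⇑(tensOfPair p) = T₀.eval`.
* §10 **`twistTest_smooth_transfer_cm_of_transferIff`** = B's `hTw` in the binder shape of v0.1 :1394 with
  `tw := fun l h f => transportTwist ψ νG h.T h.loc (forall_mul_right_eq_hasCompactSupport_heckeOff L H h) f`.
B-SIDE READING (typ2): `Smooth := 𝔨.Smooth`, `hsm := fun f′ h => (IsPinned.smooth_iff hpin f′).2 h`, `Transfer := 𝔨.Transfer`, `ψ := 𝔨.ψ`, `ArchRel := fun a a′ =>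
(letI := …; IsArchInnerTransfer L H 𝔨.mGi 𝔨.mqi a a′)` (the pin's Borel carpets), `hTiff := IsPinned.transfer_iff_local hpin`; no measure hypothesis on `νG`.
THEOREMS + one honest `def` (no instance, no notation, no named fact, no `sorry`); axioms TRIO.  HONEST LABEL: HC_CM is proved only modulo the 7 printed citations
(2 remaining named inputs: hLiu418 = stmt-HodgeConjecture-24832, h413 = stmt-HodgeConjecture-24833) until rung 0 closes; an organ pays no socket until an edition
consumes it (`hTw` ★ by name only when B ED. 5 instantiates `tw` as above); `hEP`∕`hEH` (the eigen-law) are NOT touched here; REL ≠ ★ ≠ BUILT.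

## References
[cite: Rogawski1990, §13.7 p. 206; §14.2 (14.2.1) p. 233; §14.6 p. 242 l. 10–22] [cite: BorelJacquet1979, §4.1] [cite: Flath1979, §2–§3] [cite: CartierCorvallis1979, §IV.1]
-/

set_option autoImplicit false
set_option linter.dupNamespace false  -- the mandated namespace repeats the summit's segment (`HodgeConjecture.HodgeConjecture`)

noncomputable section

open NumberField IsDedekindDomain MeasureTheory
open scoped Classical
open Literature.NumberTheory.Automorphic Literature.NumberTheory.Automorphic.UnitaryGroup

namespace Summit.HodgeConjecture.HodgeConjecture.R90.S9.PureTensorTwist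

variable {L : Type} [Field L] [NumberField L] [IsCMField L] {N : ℕ} {H H' : Matrix (Fin N) (Fin N) L}
/-! ## §6 Smoothness of the twist from RIGHT-smoothness of the kernel — NO hypothesis on the measure -/

section RightSmooth

/-- **Right-invariance under a neighbourhood of `1` ⇒ locally constant** (`Φ(m κ) = Φ(m)` for `κ ∈ V ∈ 𝓝 1`: `Φ` is constant on `m · V′`).
[cite: CartierCorvallis1979, §IV.1] [cite: BorelJacquet1979, §4.1] -/
theorem isLocallyConstant_of_forall_mul_right_eq {G Y : Type*} [Group G] [TopologicalSpace G] [ContinuousMul G]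
    {Φ : G → Y} {V : Set G} (hV : V ∈ nhds (1 : G)) (h : ∀ κ ∈ V, ∀ m, Φ (m * κ) = Φ m) : IsLocallyConstant Φ := by
  obtain ⟨V', hV'V, hV'o, h1⟩ := mem_nhds_iff.1 hV
  refine (IsLocallyConstant.iff_exists_open Φ).2 fun m => ?_
  refine ⟨(fun m' => m⁻¹ * m') ⁻¹' V', hV'o.preimage (continuous_const.mul continuous_id),
    by simpa only [Set.mem_preimage, inv_mul_cancel] using h1, fun m' hm' => ?_⟩
  have e : m * (m⁻¹ * m') = m' := mul_inv_cancel_left m m'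
  rw [← e]
  exact h _ (hV'V hm') m

/-- **`(f ⋆ k)(x κ) = (f ⋆ k)(x)` whenever `k(y κ) = k(y)` for all `y`** — right-invariance of the kernel passes to the convolution, for ANY measure
(`∫ f(u) k(u⁻¹ x κ) dν(u) = ∫ f(u) k(u⁻¹ x) dν(u)` termwise). [cite: CartierCorvallis1979, §IV.1] -/
theorem mulConv_apply_mul_right_eq {G : Type*} [Group G] [MeasurableSpace G] (ν : Measure G) (f k : G → ℂ) {U : Set G}
    (hk : ∀ κ ∈ U, ∀ y, k (y * κ) = k y) {κ : G} (hκ : κ ∈ U) (x : G) :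
    mulConv ν f k (x * κ) = mulConv ν f k x := by
  rw [mulConv_apply, mulConv_apply]
  refine integral_congr_ae (Filter.Eventually.of_forall fun u => ?_)
  show f u * k (u⁻¹ * (x * κ)) = f u * k (u⁻¹ * x)
  rw [← mul_assoc, hk κ hκ]

/-- **`f ⋆ k` IS LOCALLY CONSTANT when `k` is right-invariant under a neighbourhood of `1`** — no invariance of the measure is used.
[cite: CartierCorvallis1979, §IV.1] [cite: BorelJacquet1979, §4.1] -/
theorem isLocallyConstant_mulConv_of_forall_mul_right_eq {G : Type*} [Group G] [TopologicalSpace G] [ContinuousMul G]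
    [MeasurableSpace G] (ν : Measure G) (f k : G → ℂ) {U : Set G} (hU : U ∈ nhds (1 : G))
    (hk : ∀ κ ∈ U, ∀ y, k (y * κ) = k y) : IsLocallyConstant (mulConv ν f k) :=
  isLocallyConstant_of_forall_mul_right_eq hU fun _ hκ x => mulConv_apply_mul_right_eq ν f k hk hκ x

/-- A bi-`K`-invariant function (★ `IsLevel`, `K` compact open) is right-invariant under the neighbourhood `K` of `1`. [cite: CartierCorvallis1979, §IV.1] -/
theorem exists_nhds_forall_mul_right_eq_of_isLevel {G : Type*} [Group G] [TopologicalSpace G] {K : Subgroup G} {k : G → ℂ}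
    (hk : IsLevel K k) : ∃ U : Set G, U ∈ nhds (1 : G) ∧ ∀ κ ∈ U, ∀ y, k (y * κ) = k y :=
  ⟨K, hk.isOpen.mem_nhds K.one_mem, hk.mul_right⟩

/-- Right-smoothness TRANSPORTS along a topological group isomorphism: `k ∘ ψ⁻¹` is right-invariant under `ψ(U)`. [cite: Rogawski1990, §14.2 p. 233] -/
theorem exists_nhds_forall_mul_right_eq_comp_symm {G G' : Type*} [Group G] [Group G'] [TopologicalSpace G] [TopologicalSpace G']
    (ψ : G ≃ₜ* G') {k : G → ℂ} (hk : ∃ U : Set G, U ∈ nhds (1 : G) ∧ ∀ κ ∈ U, ∀ y, k (y * κ) = k y) :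
    ∃ U' : Set G', U' ∈ nhds (1 : G') ∧ ∀ κ ∈ U', ∀ y, (k ∘ ψ.symm) (y * κ) = (k ∘ ψ.symm) y := by
  obtain ⟨U, hU, hkU⟩ := hk
  refine ⟨ψ.symm ⁻¹' U, ?_, fun κ hκ y => ?_⟩
  · have hc : ContinuousAt (ψ.symm : G' → G) 1 := ψ.symm.continuous.continuousAt
    have h1 : (ψ.symm : G' → G) 1 = 1 := map_one ψ.symm
    rw [← h1] at hU
    exact hc.preimage_mem_nhds hU
  show k (ψ.symm (y * κ)) = k (ψ.symm y)
  rw [map_mul]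
  exact hkU _ hκ _

variable (T : PureTensor L N H) (𝒯 : Finset (HeightOneSpectrum (𝓞 ↥(maximalRealSubfield L))))
  (k : ∀ v : HeightOneSpectrum (𝓞 ↥(maximalRealSubfield L)), (cmDatum L N H).Local v → ℂ)
  (μ : ∀ v : HeightOneSpectrum (𝓞 ↥(maximalRealSubfield L)), @Measure ((cmDatum L N H).Local v) (borel _)) in
/-- **THE TWIST OF A TEST TENSOR BY RIGHT-SMOOTH COMPACTLY SUPPORTED KERNELS IS A TEST TENSOR — for ANY local measures** (no left-invariance,
no level hypothesis on `T`): `T.loc v ⋆ k_v` is locally constant by right-smoothness of `k_v` alone (`isLocallyConstant_mulConv_of_forall_mul_right_eq`)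
and compactly supported (★ `hasCompactSupport_mulConv`, ★ `PureTensor.hasCompactSupport_loc`).  The form needed on the `U(H′)` side, where the
transported kernels `h_v ∘ ψ_v⁻¹` are only `ψ_v(K_v)`-invariant. [cite: CartierCorvallis1979, §IV.1] [cite: BorelJacquet1979, §4.1] -/
theorem twistAt_isTest_of_forall_mul_right_eq (hT : T.IsTest)
    (hk : ∀ v ∈ 𝒯, (∃ U : Set ((cmDatum L N H).Local v), U ∈ nhds (1 : (cmDatum L N H).Local v) ∧ ∀ κ ∈ U, ∀ y, k v (y * κ) = k v y) ∧
      HasCompactSupport (k v)) :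
    (twistAt T 𝒯 k μ).IsTest := by
  refine ⟨twistAt_isUnramified T 𝒯 k μ hT.isUnramified, fun v hv => ?_, hT.isArchTest⟩
  rw [twistAt_S, Finset.mem_union] at hv
  by_cases hv𝒯 : v ∈ 𝒯
  · letI : MeasurableSpace ((cmDatum L N H).Local v) := borel _
    rw [twistAt_loc_of_mem T 𝒯 k μ hv𝒯]
    obtain ⟨⟨U, hU, hkU⟩, hkc⟩ := hk v hv𝒯
    exact ⟨isLocallyConstant_mulConv_of_forall_mul_right_eq (μ v) (T.loc v) (k v) hU hkU,
      hasCompactSupport_mulConv (μ v) (PureTensor.hasCompactSupport_loc hT.isUnramified hT.isFinSmooth v) hkc⟩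
  · rw [twistAt_loc_of_not_mem T 𝒯 k μ hv𝒯]
    exact hT.isFinSmooth v (hv.resolve_right hv𝒯)

/-- **Transported kernel data**: if the kernels `k_v` (`v ∈ 𝒯`) are right-smooth and compactly supported, so are `k_v ∘ ψ_v⁻¹` on `U(H′)(L⁺_v)`.
[cite: Rogawski1990, §14.2 p. 233] -/
theorem forall_mul_right_eq_hasCompactSupport_comp_symm
    (ψ : ∀ v : HeightOneSpectrum (𝓞 ↥(maximalRealSubfield L)), (cmDatum L N H).Local v ≃ₜ* (cmDatum L N H').Local v)
    {𝒯 : Finset (HeightOneSpectrum (𝓞 ↥(maximalRealSubfield L)))}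
    {k : ∀ v : HeightOneSpectrum (𝓞 ↥(maximalRealSubfield L)), (cmDatum L N H).Local v → ℂ}
    (hk : ∀ v ∈ 𝒯, (∃ U : Set ((cmDatum L N H).Local v), U ∈ nhds (1 : (cmDatum L N H).Local v) ∧ ∀ κ ∈ U, ∀ y, k v (y * κ) = k v y) ∧
      HasCompactSupport (k v)) :
    ∀ v ∈ 𝒯, (∃ U' : Set ((cmDatum L N H').Local v), U' ∈ nhds (1 : (cmDatum L N H').Local v) ∧
        ∀ κ ∈ U', ∀ y, (k v ∘ (ψ v).symm) (y * κ) = (k v ∘ (ψ v).symm) y) ∧ HasCompactSupport (k v ∘ (ψ v).symm) :=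
  fun v hv => ⟨exists_nhds_forall_mul_right_eq_comp_symm (ψ v) (hk v hv).1, (hk v hv).2.comp_homeomorph (ψ v).symm.toHomeomorph⟩

end RightSmooth

/-! ## §7 The loc-level commutation for ANY locally matching pair `T′.loc = T.loc ∘ ψ⁻¹` -/

/-- **TWISTS OF LOCALLY MATCHING TENSORS MATCH LOCALLY**: if `T′.loc v = T.loc v ∘ ψ_v⁻¹` at every finite `v` (the pin `PinTransferIff`'s clause), then the
twist of `T′` by the transported kernels `k_v ∘ ψ_v⁻¹` w.r.t. `(ψ_v)_* μ_v` and the twist of `T` by `k_v` w.r.t. `μ_v` again match locally (§5 `mulConv_map_comp_symm`).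
[cite: Rogawski1990, §14.2 (14.2.1) p. 233; §13.7 p. 206] [cite: CartierCorvallis1979, §IV.1] -/
theorem twistAt_loc_eq_comp_symm
    (ψ : ∀ v : HeightOneSpectrum (𝓞 ↥(maximalRealSubfield L)), (cmDatum L N H).Local v ≃ₜ* (cmDatum L N H').Local v)
    (T : PureTensor L N H) (T' : PureTensor L N H') (hloc : ∀ v, T'.loc v = T.loc v ∘ (ψ v).symm)
    (𝒯 : Finset (HeightOneSpectrum (𝓞 ↥(maximalRealSubfield L))))
    (k : ∀ v : HeightOneSpectrum (𝓞 ↥(maximalRealSubfield L)), (cmDatum L N H).Local v → ℂ)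
    (μ : ∀ v : HeightOneSpectrum (𝓞 ↥(maximalRealSubfield L)), @Measure ((cmDatum L N H).Local v) (borel _))
    (v : HeightOneSpectrum (𝓞 ↥(maximalRealSubfield L))) :
    (twistAt T' 𝒯 (fun w => k w ∘ (ψ w).symm) (fun w => @Measure.map _ _ (borel _) (borel _) (ψ w) (μ w))).loc v =
      (twistAt T 𝒯 k μ).loc v ∘ (ψ v).symm := by
  by_cases hv : v ∈ 𝒯
  · rw [twistAt_loc_of_mem _ 𝒯 _ _ hv, twistAt_loc_of_mem T 𝒯 k μ hv, hloc v]
    letI : MeasurableSpace ((cmDatum L N H).Local v) := borel _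
    haveI : BorelSpace ((cmDatum L N H).Local v) := ⟨rfl⟩
    letI : MeasurableSpace ((cmDatum L N H').Local v) := borel _
    haveI : BorelSpace ((cmDatum L N H').Local v) := ⟨rfl⟩
    exact mulConv_map_comp_symm (ψ v) (μ v) (T.loc v) (k v)
  · rw [twistAt_loc_of_not_mem _ 𝒯 _ _ hv, twistAt_loc_of_not_mem T 𝒯 k μ hv, hloc v]

/-! ## §8 `transportTwist` — THE CLOSED TWIST ON THE `U(H′)` SIDE (B's ∃-data `tw`) -/

section TransportTwist

variable (ψ : ∀ v : HeightOneSpectrum (𝓞 ↥(maximalRealSubfield L)), (cmDatum L N H).Local v ≃ₜ* (cmDatum L N H').Local v)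
  (μ : ∀ v : HeightOneSpectrum (𝓞 ↥(maximalRealSubfield L)), @Measure ((cmDatum L N H).Local v) (borel _))
  (𝒯 : Finset (HeightOneSpectrum (𝓞 ↥(maximalRealSubfield L))))
  (k : ∀ v : HeightOneSpectrum (𝓞 ↥(maximalRealSubfield L)), (cmDatum L N H).Local v → ℂ)
  (hk : ∀ v ∈ 𝒯, (∃ U : Set ((cmDatum L N H).Local v), U ∈ nhds (1 : (cmDatum L N H).Local v) ∧ ∀ κ ∈ U, ∀ y, k v (y * κ) = k v y) ∧
    HasCompactSupport (k v))

/-- **`transportTwist ψ μ 𝒯 k hk f` — THE HECKE TWIST `f ↦ f ∗ h^ψ` ON `C_c(U(H′)(𝔸))`, CLOSED**: if `f` is smooth (`⇑f = T′.eval` for some TEST pure tensor `T′`),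
the twist of a CHOSEN such `T′` by the transported kernels `k_v ∘ ψ_v⁻¹` (`v ∈ 𝒯`) w.r.t. the pushed-forward measures `(ψ_v)_* μ_v`, packaged in `C_c` (★ `PureTensor.toCc`;
a test tensor by §6); otherwise the junk value `0` (off the smooth class no S9 identity is consumed).  By §4 the underlying FUNCTION does not depend on the choice
(`coe_transportTwist`).  This is the `tw l h f` of FILE B ED. 4's producer (`𝒯 := h.T`, `k := h.loc`, `μ := νG`, `ψ := 𝔨.ψ`).
[cite: Rogawski1990, §14.6 p. 242 l. 10–22; §14.2 (14.2.1) p. 233; §13.7 p. 206] [cite: CartierCorvallis1979, §IV.1] -/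
def transportTwist (f : CompactlySupportedContinuousMap (cmDatum L N H').Adelic ℂ) : CompactlySupportedContinuousMap (cmDatum L N H').Adelic ℂ :=
  if hf : ∃ T' : PureTensor L N H', T'.IsTest ∧ ⇑f = T'.eval then
    haveI hT := twistAt_isTest_of_forall_mul_right_eq hf.choose 𝒯 (fun w => k w ∘ (ψ w).symm)
      (fun w => @Measure.map _ _ (borel _) (borel _) (ψ w) (μ w)) hf.choose_spec.1 (forall_mul_right_eq_hasCompactSupport_comp_symm ψ hk)
    (twistAt hf.choose 𝒯 (fun w => k w ∘ (ψ w).symm) (fun w => @Measure.map _ _ (borel _) (borel _) (ψ w) (μ w))).toCc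
      hT.isUnramified hT.isArchTest.continuous_arch hT.isArchTest.hasCompactSupport_arch
      (fun v hv => (hT.isFinSmooth v hv).1.continuous) (fun v hv => (hT.isFinSmooth v hv).2)
  else 0

/-- Off the smooth class `transportTwist … f = 0` (junk). [cite: Rogawski1990, §14.2 p. 233] -/
theorem transportTwist_of_not {f : CompactlySupportedContinuousMap (cmDatum L N H').Adelic ℂ}
    (hf : ¬ ∃ T' : PureTensor L N H', T'.IsTest ∧ ⇑f = T'.eval) : transportTwist ψ μ 𝒯 k hk f = 0 := by
  unfold transportTwist
  rw [dif_neg hf]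

/-- **`transportTwist` IN ANY TEST PRESENTATION** (presentation-free by §4): for EVERY test tensor `T′` with `⇑f = T′.eval`,
`⇑(transportTwist ψ μ 𝒯 k hk f) = (twistAt T′ 𝒯 (k · ∘ ψ⁻¹) (ψ_* μ)).eval`. [cite: Rogawski1990, §14.2 p. 233; §13.7 p. 206] [cite: Flath1979, §2–§3] -/
theorem coe_transportTwist {f : CompactlySupportedContinuousMap (cmDatum L N H').Adelic ℂ} (T' : PureTensor L N H') (hT' : T'.IsTest)
    (hf : ⇑f = T'.eval) :
    ⇑(transportTwist ψ μ 𝒯 k hk f) =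
      (twistAt T' 𝒯 (fun w => k w ∘ (ψ w).symm) (fun w => @Measure.map _ _ (borel _) (borel _) (ψ w) (μ w))).eval := by
  have hex : ∃ T'' : PureTensor L N H', T''.IsTest ∧ ⇑f = T''.eval := ⟨T', hT', hf⟩
  unfold transportTwist
  rw [dif_pos hex]
  funext g
  rw [PureTensor.toCc_apply]
  exact congrFun (eval_twistAt_eq_of_eval_eq _ _ hex.choose_spec.1.isUnramified hT'.isUnramified (hex.choose_spec.2.symm.trans hf) _ _ _) g

/-- **`transportTwist` OF A SMOOTH FUNCTION IS SMOOTH**: it is the `eval` of a TEST pure tensor. [cite: Rogawski1990, §14.2 p. 233] -/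
theorem exists_isTest_coe_transportTwist {f : CompactlySupportedContinuousMap (cmDatum L N H').Adelic ℂ} (T' : PureTensor L N H') (hT' : T'.IsTest)
    (hf : ⇑f = T'.eval) :
    ∃ T'' : PureTensor L N H', T''.IsTest ∧ ⇑(transportTwist ψ μ 𝒯 k hk f) = T''.eval :=
  ⟨_, twistAt_isTest_of_forall_mul_right_eq T' 𝒯 _ _ hT' (forall_mul_right_eq_hasCompactSupport_comp_symm ψ hk),
    coe_transportTwist ψ μ 𝒯 k hk T' hT' hf⟩

/-- **A TWIST OF A TRANSFER IS A TRANSFER OF THE TWIST** — for ANY transfer predicate PINNED to local matching along `ψ` (the text of `PinTransferIff`: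
`Transfer f′ f ↔ ∃ T T′ test, ⇑f′ = T.eval ∧ ⇑f = T′.eval ∧ (∀ v, T′.loc v = T.loc v ∘ ψ_v⁻¹) ∧ ArchRel T.arch T′.arch`, `ArchRel` = the kit's archimedean inner
transfer, opaque here): if `Transfer f′ f` and `g′` is ANY function twisting a factorisation of `f′` (`⇑g′ = (twistAt T₁ 𝒯 k μ).eval`, `⇑f′ = T₁.eval`), then
`Transfer g′ (transportTwist ψ μ 𝒯 k hk f)`.  Witnesses: the twists of the pin's own pair `(T, T′)`; test by §6, evals by §4 + `coe_transportTwist`, local matching by §7,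
archimedean factors untouched. [cite: Rogawski1990, §14.6 p. 242 l. 10–22; §14.2 (14.2.1) p. 233; §13.7 p. 206] [cite: CartierCorvallis1979, §IV.1] -/
theorem transfer_twistAt_transportTwist
    (Transfer : CompactlySupportedContinuousMap (cmDatum L N H).Adelic ℂ → CompactlySupportedContinuousMap (cmDatum L N H').Adelic ℂ → Prop)
    (ArchRel : (UnitaryGroup.arch (↥(maximalRealSubfield L)) L (IsCMField.complexConj L) N H → ℂ) →
      (UnitaryGroup.arch (↥(maximalRealSubfield L)) L (IsCMField.complexConj L) N H' → ℂ) → Prop)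
    (hTiff : ∀ (f' : CompactlySupportedContinuousMap (cmDatum L N H).Adelic ℂ) (f : CompactlySupportedContinuousMap (cmDatum L N H').Adelic ℂ),
      Transfer f' f ↔ ∃ (T : PureTensor L N H) (T' : PureTensor L N H'), (T.IsTest ∧ T'.IsTest) ∧ ⇑f' = T.eval ∧ ⇑f = T'.eval ∧
        (∀ v, T'.loc v = T.loc v ∘ (ψ v).symm) ∧ ArchRel T.arch T'.arch)
    {f' g' : CompactlySupportedContinuousMap (cmDatum L N H).Adelic ℂ} {f : CompactlySupportedContinuousMap (cmDatum L N H').Adelic ℂ}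
    (h : Transfer f' f) {T₁ : PureTensor L N H} (hT₁ : T₁.IsUnramified) (hf' : ⇑f' = T₁.eval) (hg' : ⇑g' = (twistAt T₁ 𝒯 k μ).eval) :
    Transfer g' (transportTwist ψ μ 𝒯 k hk f) := by
  obtain ⟨T, T', ⟨hT, hT'⟩, hfT, hfT', hloc, harch⟩ := (hTiff f' f).1 h
  refine (hTiff _ _).2 ⟨twistAt T 𝒯 k μ,
    twistAt T' 𝒯 (fun w => k w ∘ (ψ w).symm) (fun w => @Measure.map _ _ (borel _) (borel _) (ψ w) (μ w)),
    ⟨twistAt_isTest_of_forall_mul_right_eq T 𝒯 k μ hT hk,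
      twistAt_isTest_of_forall_mul_right_eq T' 𝒯 _ _ hT' (forall_mul_right_eq_hasCompactSupport_comp_symm ψ hk)⟩, ?_, ?_, ?_, ?_⟩
  · rw [hg']
    exact eval_twistAt_eq_of_eval_eq _ _ hT₁ hT.isUnramified (hf'.symm.trans hfT) _ _ _
  · exact coe_transportTwist ψ μ 𝒯 k hk T' hT' hfT'
  · exact fun v => twistAt_loc_eq_comp_symm ψ T T' hloc 𝒯 k μ v
  · exact harch

end TransportTwist

end Summit.HodgeConjecture.HodgeConjecture.R90.S9.PureTensorTwist

/-! ## §9 THE `U(H)` SIDE AT `N = 3`: the pair twist `twistTest` realised by `tensOfPair` IS the tensor twist; FILE B's `hTw` -/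

namespace Summit.HodgeConjecture.HodgeConjecture.R90.S9

open scoped Matrix
open Literature.NumberTheory Literature.NumberTheory.Rogawski1990
open Summit.HodgeConjecture.HodgeConjecture.Cruxes.H413
open Summit.HodgeConjecture.HodgeConjecture.Cruxes.H413.F0P3InnerFormClassificationV6 (TestG TestGp splitForm Places)
open Summit.HodgeConjecture.HodgeConjecture.Cruxes.H413.F0P3TestFunctionsOfRecord (Unr₀)
open Summit.HodgeConjecture.HodgeConjecture.Cruxes.H413.F0P3UnrTensorInstance (UnrTensor)
open Summit.HodgeConjecture.HodgeConjecture.Cruxes.H413.F0P3SemilocalTestFunctionsOfRecord (toPureTensor toPureTensor_S coe_tens₀)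
open Summit.HodgeConjecture.HodgeConjecture.R90.S9.InnerFormSec146
open Summit.HodgeConjecture.HodgeConjecture.R90.S9.PureTensorTwist

section PairSide

variable (L : Type) [Field L] [NumberField L] [IsCMField L] (ι : L →+* ℂ) (H : Matrix (Fin 3) (Fin 3) L) (T : GL (Fin 3) ℂ)
  (hT : (T : Matrix (Fin 3) (Fin 3) ℂ)ᴴ * H.map ι * (T : Matrix (Fin 3) (Fin 3) ℂ) = Literature.Geometry.ComplexHyperbolic.BallModel.J)
  (μv : ∀ v : Places L, @Measure ((cmDatum L 3 H).Local v) (borel _))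

/-- **An unramified Hecke tensor off the level supplies right-smooth compactly supported kernels** (`h.hlev`: bi-`K_v`-invariant; `h.hcs`) — the `hk` datum of
`transportTwist` for B's `tw l h := transportTwist 𝔨.ψ νG h.T h.loc (forall_mul_right_eq_hasCompactSupport_heckeOff h)`. [cite: Rogawski1990, §13.7 p. 206] [cite: CartierCorvallis1979, §IV.1] -/
theorem forall_mul_right_eq_hasCompactSupport_heckeOff {l : Level L} (h : HeckeOff L H l) :
    ∀ v ∈ h.T, (∃ U : Set ((cmDatum L 3 H).Local v), U ∈ nhds (1 : (cmDatum L 3 H).Local v) ∧ ∀ κ ∈ U, ∀ y, h.loc v (y * κ) = h.loc v y) ∧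
      HasCompactSupport (h.loc v) :=
  fun v _ => ⟨exists_nhds_forall_mul_right_eq_of_isLevel (h.hlev v), h.hcs v⟩

/-- **THE TEST PREDICATE `𝓕₀` IS CLOSED UNDER THE PAIR TWIST — for ANY local measures** (right-smoothness of `h_v`, §6; compact supports multiply; the
non-unit set grows by at most `h.T`). [cite: Rogawski1990, §14.6 p. 242 l. 10–22; §13.7 p. 206] [cite: CartierCorvallis1979, §IV.1] -/
theorem testPred_twistTest (l : Level L) (h : HeckeOff L H l)
    (p : (UnitaryGroup.arch (↥(maximalRealSubfield L)) L (IsCMField.complexConj L) 3 H → ℂ) × (∀ v : Places L, (cmDatum L 3 H).Local v → ℂ))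
    (hp : ArchTestKc L ι H T hT p.1 ∧ (∀ v : Places L, IsLocallyConstant (p.2 v) ∧ HasCompactSupport (p.2 v)) ∧
      {v : Places L | p.2 v ≠ (cmLocalIntegralLevel L 3 H v : Set ((cmDatum L 3 H).Local v)).indicator fun _ => (1 : ℂ)}.Finite) :
    ArchTestKc L ι H T hT (twistTest L H μv l h p).1 ∧
      (∀ v : Places L, IsLocallyConstant ((twistTest L H μv l h p).2 v) ∧ HasCompactSupport ((twistTest L H μv l h p).2 v)) ∧
      {v : Places L | (twistTest L H μv l h p).2 v ≠
        (cmLocalIntegralLevel L 3 H v : Set ((cmDatum L 3 H).Local v)).indicator fun _ => (1 : ℂ)}.Finite := by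
  refine ⟨hp.1, fun v => ?_, ?_⟩
  · by_cases hv : v ∈ h.T
    · rw [twistTest_snd_of_mem L H μv l h p hv]
      letI : MeasurableSpace ((cmDatum L 3 H).Local v) := borel _
      obtain ⟨U, hU, hkU⟩ := exists_nhds_forall_mul_right_eq_of_isLevel (h.hlev v)
      exact ⟨isLocallyConstant_mulConv_of_forall_mul_right_eq (μv v) (p.2 v) (h.loc v) hU hkU,
        hasCompactSupport_mulConv (μv v) (hp.2.1 v).2 (h.hcs v)⟩
    · rw [twistTest_snd_of_not_mem L H μv l h p hv]
      exact hp.2.1 v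
  · refine (hp.2.2.union h.T.finite_toSet).subset fun v hv => ?_
    by_cases hvT : v ∈ h.T
    · exact Or.inr hvT
    · left
      have hv' : (twistTest L H μv l h p).2 v ≠ _ := hv
      rw [twistTest_snd_of_not_mem L H μv l h p hvT] at hv'
      exact hv'

/-- **THE PAIR TWIST REALISED IS THE TENSOR TWIST OF ANY FACTORISATION**: for a `𝓕₀`-pair `p` and ANY unramified `T₀` with `⇑(tensOfPair p) = T₀.eval`,
`⇑(tensOfPair (twistTest l h p)) = (twistAt T₀ h.T h.loc μ).eval` — the canonical presentation of the twisted pair on `S_p ∪ h.T` (★ `tensOfPair_eq_tens₀`) has the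
factors of `twistAt T_p h.T h.loc μ` (`T_p` = the canonical tensor of `p`, ★ `toPureTensor_testS₀OfPair_unit_loc`), nested bad sets and integral levels
(★ `PureTensor.eval_eq_of_subset`), and `T_p ↝ T₀` is §4. [cite: Rogawski1990, §14.2 p. 233; §13.7 p. 206] [cite: BorelJacquet1979, §4.1] [cite: Flath1979, §2–§3] -/
theorem coe_tensOfPair_twistTest (l : Level L) (h : HeckeOff L H l)
    (p : (UnitaryGroup.arch (↥(maximalRealSubfield L)) L (IsCMField.complexConj L) 3 H → ℂ) × (∀ v : Places L, (cmDatum L 3 H).Local v → ℂ))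
    (hp : ArchTestKc L ι H T hT p.1 ∧ (∀ v : Places L, IsLocallyConstant (p.2 v) ∧ HasCompactSupport (p.2 v)) ∧
      {v : Places L | p.2 v ≠ (cmLocalIntegralLevel L 3 H v : Set ((cmDatum L 3 H).Local v)).indicator fun _ => (1 : ℂ)}.Finite)
    {T₀ : PureTensor L 3 H} (hT₀ : T₀.IsUnramified) (hpT : ⇑(tensOfPair L H ι T hT p) = T₀.eval) :
    ⇑(tensOfPair L H ι T hT (twistTest L H μv l h p)) = (twistAt T₀ h.T h.loc μv).eval := by
  -- the canonical presentation of `p` on its non-unit set `S`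
  set S : Finset (Places L) := hp.2.2.toFinset with hS_def
  have hS : ∀ v : Places L, v ∉ S → p.2 v = (cmLocalIntegralLevel L 3 H v : Set ((cmDatum L 3 H).Local v)).indicator fun _ => (1 : ℂ) := by
    intro v hv
    by_contra hne
    exact hv (hp.2.2.mem_toFinset.2 hne)
  have hTp : ⇑(tensOfPair L H ι T hT p) = (toPureTensor S (testS₀OfPair L H ι T hT S p.1 p.2 hp.1 hp.2.1) (UnrTensor.unit : Unr₀ L H S)).eval := by
    rw [tensOfPair_eq_tens₀ L H ι T hT hp S hS, coe_tens₀]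
  -- the canonical presentation of the twisted pair on `S ∪ h.T`
  have hq := testPred_twistTest L ι H T hT μv l h p hp
  have hS' : ∀ v : Places L, v ∉ S ∪ h.T →
      (twistTest L H μv l h p).2 v = (cmLocalIntegralLevel L 3 H v : Set ((cmDatum L 3 H).Local v)).indicator fun _ => (1 : ℂ) := by
    intro v hv
    rw [Finset.mem_union, not_or] at hv
    rw [twistTest_snd_of_not_mem L H μv l h p hv.2]
    exact hS v hv.1
  rw [tensOfPair_eq_tens₀ L H ι T hT hq (S ∪ h.T) hS', coe_tens₀,
    ← eval_twistAt_eq_of_eval_eq _ T₀ (PureTensor.ofUnramified_isUnramified _ _ _) hT₀ (hTp.symm.trans hpT) h.T h.loc μv]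
  refine PureTensor.eval_eq_of_subset
    (twistAt (toPureTensor S (testS₀OfPair L H ι T hT S p.1 p.2 hp.1 hp.2.1) (UnrTensor.unit : Unr₀ L H S)) h.T h.loc μv) _
    (fun v hv => ?_) (fun _ => rfl) (fun v => ?_) rfl
  · -- nested bad sets: `(S ∪ ∅) ∪ h.T ⊆ (S ∪ h.T) ∪ ∅`
    simp only [twistAt_S, toPureTensor_S, Finset.mem_union] at hv ⊢
    rcases hv with (hv | hv) | hv
    · exact Or.inl (Or.inl hv)
    · exact Or.inr hv
    · exact Or.inl (Or.inr hv)
  · -- the same local factors everywhere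
    rw [toPureTensor_testS₀OfPair_unit_loc L H ι T hT hq.1 hq.2.1 hS' v]
    by_cases hv : v ∈ h.T
    · rw [twistAt_loc_of_mem _ _ _ _ hv, toPureTensor_testS₀OfPair_unit_loc L H ι T hT hp.1 hp.2.1 hS v,
        twistTest_snd_of_mem L H μv l h p hv]
    · rw [twistAt_loc_of_not_mem _ _ _ _ hv, toPureTensor_testS₀OfPair_unit_loc L H ι T hT hp.1 hp.2.1 hS v,
        twistTest_snd_of_not_mem L H μv l h p hv]

end PairSide

/-! ## §10 FILE B's `hTw` — the twist producer group, in the binder shape of v0.1 :1394, with `tw := transportTwist ψ νG h.T h.loc …` -/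

section HTw

variable (L : Type) [Field L] [NumberField L] [IsCMField L] (ι : L →+* ℂ) (H : Matrix (Fin 3) (Fin 3) L) (T : GL (Fin 3) ℂ)
  (hT : (T : Matrix (Fin 3) (Fin 3) ℂ)ᴴ * H.map ι * (T : Matrix (Fin 3) (Fin 3) ℂ) = Literature.Geometry.ComplexHyperbolic.BallModel.J)

/-- **`hTw` FROM THE TRANSFER PIN — «A TWIST OF A TRANSFER IS A TRANSFER OF THE TWIST» ON THE RECORD'S TEST PAIRS.**  For the kit's predicates
`Smooth : TestGp L H → Prop` (pin (iv) «if» half `hsm`) and `Transfer : TestGp L H → TestG L → Prop` PINNED to local matching along `ψ` (`hTiff` = the text of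
`PinTransferIff`, B: `IsPinned.transfer_iff_local hpin`, with `ArchRel := IsArchInnerTransfer L H 𝔨.mGi 𝔨.mqi` under its Borel carpets), ANY local measures `νG`
and ANY `l₁`: for every level `l ⊇ l₁`, Hecke tensor `h` off `l`, level test pair `f′` and `f` with `Smooth_cm f′ ∧ Transfer_cm f′ f`, the twisted pair
`twistTest l h f′` is `Smooth_cm` (★ `smooth_tensOfPair_of_kitLaw` on `𝓕₀ (f′ ∗ h)`, §9) and `Transfer_cm (twistTest l h f′) (transportTwist ψ νG h.T h.loc _ f)`
(guard ★ `isKcBiInv_tensOfPair`; transfer = §8 `transfer_twistAt_transportTwist` at the canonical factorisation of `f′`, §9 `coe_tensOfPair_twistTest`).  So B's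
∃-data `tw` is CLOSED as `fun l h f => transportTwist 𝔨.ψ νG h.T h.loc (forall_mul_right_eq_hasCompactSupport_heckeOff L H h) f` and the socket `hTw` is PAID by
this theorem; `IsLevelTest l f′` and `l₁ ⊆ l` are carried unused (binders of the socket). [cite: Rogawski1990, §14.6 p. 242 l. 10–22; §14.2 (14.2.1) p. 233; §13.7 p. 206]
[cite: CartierCorvallis1979, §IV.1] [cite: BorelJacquet1979, §4.1] -/
theorem twistTest_smooth_transfer_cm_of_transferIff
    (Smooth : TestGp L H → Prop) (hsm : ∀ f' : TestGp L H, (∃ T' : PureTensor L 3 H, T'.IsTest ∧ ⇑f' = T'.eval) → Smooth f')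
    (Transfer : TestGp L H → TestG L → Prop)
    (ψ : ∀ v : Places L, (cmDatum L 3 H).Local v ≃ₜ* (cmDatum L 3 (splitForm L 3)).Local v)
    (ArchRel : (UnitaryGroup.arch (↥(maximalRealSubfield L)) L (IsCMField.complexConj L) 3 H → ℂ) →
      (UnitaryGroup.arch (↥(maximalRealSubfield L)) L (IsCMField.complexConj L) 3 (splitForm L 3) → ℂ) → Prop)
    (hTiff : ∀ (f' : TestGp L H) (f : TestG L), Transfer f' f ↔
      ∃ (T₁ : PureTensor L 3 H) (T' : PureTensor L 3 (splitForm L 3)), (T₁.IsTest ∧ T'.IsTest) ∧ ⇑f' = T₁.eval ∧ ⇑f = T'.eval ∧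
        (∀ v, T'.loc v = T₁.loc v ∘ (ψ v).symm) ∧ ArchRel T₁.arch T'.arch)
    (νG : ∀ v : Places L, @Measure ((cmDatum L 3 H).Local v) (borel _)) (l₁ : Level L) :
    ∀ (l : Level L), l₁ ⊆ l → ∀ (h : HeckeOff L H l)
      (f' : (UnitaryGroup.arch (↥(maximalRealSubfield L)) L (IsCMField.complexConj L) 3 H → ℂ) × (∀ v : Places L, (cmDatum L 3 H).Local v → ℂ))
      (f : TestG L), IsLevelTest L ι H T hT l f' → (Smooth_cm L ι H T hT Smooth f' ∧ Transfer_cm L ι H T hT Transfer f' f) →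
      (Smooth_cm L ι H T hT Smooth (twistTest L H νG l h f') ∧
        Transfer_cm L ι H T hT Transfer (twistTest L H νG l h f')
          (transportTwist ψ νG h.T h.loc (forall_mul_right_eq_hasCompactSupport_heckeOff L H h) f)) := by
  intro l _ h f' f _ hst
  obtain ⟨⟨hp, -⟩, -, htr⟩ := hst
  have hq := testPred_twistTest L ι H T hT νG l h f' hp
  refine ⟨⟨hq, smooth_tensOfPair_of_kitLaw L ι H T hT Smooth hsm _ hq⟩, isKcBiInv_tensOfPair L H ι T hT _, ?_⟩
  -- the canonical factorisation of `f′`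
  have hS : ∀ v : Places L, v ∉ hp.2.2.toFinset →
      f'.2 v = (cmLocalIntegralLevel L 3 H v : Set ((cmDatum L 3 H).Local v)).indicator fun _ => (1 : ℂ) := by
    intro v hv
    by_contra hne
    exact hv (hp.2.2.mem_toFinset.2 hne)
  have hTp : ⇑(tensOfPair L H ι T hT f') =
      (toPureTensor hp.2.2.toFinset (testS₀OfPair L H ι T hT hp.2.2.toFinset f'.1 f'.2 hp.1 hp.2.1)
        (UnrTensor.unit : Unr₀ L H hp.2.2.toFinset)).eval := by
    rw [tensOfPair_eq_tens₀ L H ι T hT hp _ hS, coe_tens₀]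
  exact transfer_twistAt_transportTwist ψ νG h.T h.loc (forall_mul_right_eq_hasCompactSupport_heckeOff L H h) Transfer ArchRel hTiff htr
    (PureTensor.ofUnramified_isUnramified _ _ _) hTp
    (coe_tensOfPair_twistTest L ι H T hT νG l h f' hp (PureTensor.ofUnramified_isUnramified _ _ _) hTp)

end HTw

end Summit.HodgeConjecture.HodgeConjecture.R90.S9

end
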